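import Summits.QuantumFields.YangMills.Theorems.BalabanUVNodesN15TwoSpacingGluingRecordKnitRightDefectCube
import Summits.QuantumFields.YangMills.Theorems.BalabanUVNodesN15TwoSpacingGluingRecordKnitRightRemainder
import HarnessLib

/-!
# THE GLUING STEP AT TWO LATTICE SPACINGS, LXIV: THE SOURCE-SIDE NONLOCAL DEFECT OF THE RECORD COVER's CUT LIFTED CUBES, HYPOTHESIS-FREE, VOLUME FREE
# (dag-n15-c g14, FILE 107; N15 = NE2, s1 «background-layer OPERATOR ingredient»)

Cell `pub-ymgap`, seat `pub-ymgap-dag-n15-c` (R134 (a); HUMAN RULING D-0062), generation 14.  `bears_on: R4∕N15 · K3⁸ SpineGivenEndpointR13SepCoPHV (stmt-QuantumFields-27366)`.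
Filed `--supports stmt-QuantumFields-27366 --as helper` — COUNT-NEUTRAL.  Theorems only (0 `def`, 0 `sorry`).  Imports BY NAME FILE 105 `…RecordKnitRightDefectCube` (`hasMaj_idef_cut_comp_commOp_nonlocal_of_row`;
through it FILE 100 `nonlocalConst_le`, FILE 99 `hasMaj_idef_nonlocal_family`, `maj₀_weaken` ∕ `maj₂_weaken`) and FILE 104 `…RecordKnitRightRemainder` (for FILE 73 `knitGR` ∕ `knitHR` ∕ `MP_eq_two_mul` and
programme P's oleans: P-IId `hasMaj_chiCube_liftCubeG_fine`, P-IIc `hasMaj_idef_chiCube_liftCubeG`, `hasMaj_landauRe`); nothing in the tree is modified.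

WHAT.  ★★★ **`hasMaj_idef_chiCube_knitGR_comp_commOp_nonlocal`** — the record twin of FILE 100 §3 `hasMaj_idef_chiCube_neumannCubeG_comp_commOp_nonlocal`: for odd `L ≥ 3`, `a > 0` there are
`δ_N, γ_N > 0`, `r_N ≥ 0` such that for all `s`, `m_T ≥ s + 1`, `K ≥ 1`, refinements `r` and cubes `□_k` of FILE 73's record cover, on the torus of record `MP (paramsOf d L m_T K hL)`,
  `𝔇((M_{χ′}G′^{↑}(□_k))∘[a•Q′*Q′ − ∂Π∂*′, M_{h′_k}], (M_χG^{↑}(□_k))∘[a•Q*Q − ∂Π∂*, M_{h_k}]) ≤ 1_{□_k}(y)·r_N·(L^K)^{−γ_N}·e^{−δ_N|y−y′|_T}`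
(`γ_N = 1∕16`), `δ_N, r_N` free of `s`, of the volume `m_T`, of `K` and of `r` — FILE 105 §2 fed with programme P's fine cut row of the LIFTED cube (P-IId) and its two-grid defect (P-IIc,
`γ = 1∕8`), dag-n15-a `hasMaj_landauRe` (both spacings) and FILE 99 `hasMaj_idef_nonlocal_family` (`γ = 1∕8`), all at one rate; `ℓ = ω = π(d+1)∕L^s ≤ π(d+1)`, `o ≤ π(d+1)(L^K)^{−1∕16}`.

HONEST FRAMING ∕ LIMITS.  Block-majorant bookkeeping over LANDED rows; `U ≡ 1` MODEL of [B6] §2's machine on the torus of record (cube letters from each cube's own doubled torus via programme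
P: not circular in the volume); constants crude and ours; nothing of [B5]∕[B6] (2.38)–(2.40)∕[B9] Thm 3.1, 3.14 asserted ([B9] Thm 3.14 = difference TEMPLATE).  NE2⁺ NOT PRINTED, NOT proved;
N15 NOT discharged; counts of record UNMOVED (typed 28∕28 · discharged 5∕27); one finite 𝕋⁴ at fixed ε per index — NOT infinite volume, NOT OS on ℝ⁴, NOT a mass gap, NOT Clay; R4 closes
`BalabanLadder.UV` only.  Restate-immune (no Theses import).
-/

noncomputable section

namespace Summit.QuantumFields.YangMills.BalabanUVNodes.N15.Gluing

open Literature.MathematicalPhysics.QuantumFieldTheory.Balaban1983to89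
open Literature.MathematicalPhysics.QuantumFieldTheory.Balaban1983to89.B5Prop11Plancherel (Tor fine unitVec)
open Literature.MathematicalPhysics.QuantumFieldTheory.Balaban1983to89.B11SectG (BlockNorm HasMaj hasMaj_zero)
open Literature.MathematicalPhysics.QuantumFieldTheory.Balaban1983to89.B6Prop26Gluing (mulOp ind ind_nonneg ind_le_one)
open Literature.MathematicalPhysics.QuantumFieldTheory.Balaban1983to89.T4EtaRateDefect (idef idef_comp idef_add idef_sub idef_zero)
open Literature.MathematicalPhysics.QuantumFieldTheory.Balaban1983to89.T4EtaRateCoeffDefect (pull)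
open Literature.MathematicalPhysics.QuantumFieldTheory.Balaban1983to89.B6UnitTorusCarrier (unitTorusGeo)
open Literature.MathematicalPhysics.QuantumFieldTheory.Balaban1983to89.B5SiteBridgeP12 (MP)
open Literature.MathematicalPhysics.QuantumFieldTheory.King1986.Torus (blockOf tdistT tdistT_nonneg)
open Summit.QuantumFields.YangMills.BalabanUVNodes.N15.VectorPiece (bshiftEquiv kingPrV blkFine blkFine_apply)
open Summit.QuantumFields.YangMills.BalabanUVNodes.N15.TwoGrid (paramsOf deltaOp gOp symOp symbOp sD sTinv chiCube cubeBlocks landauRe qvRe qvAdjRe MP_dvd_MP liftCubeG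
  hasMaj_landauRe hasMaj_chiCube_liftCubeG_fine hasMaj_idef_chiCube_liftCubeG)

variable {d : ℕ}

/-! ## ★★★ The source-side nonlocal defect of the record cover's cut lifted cubes -/

section Family

open Real

variable {L : ℕ} [NeZero L]

/-- ★★★ **THE SOURCE-SIDE NONLOCAL DEFECT OF THE RECORD COVER's CUT LIFTED CUBES, HYPOTHESIS-FREE, VOLUME FREE** — the record twin of FILE 100 §3: for odd `L ≥ 3`, `a > 0` there are
`δ_N, γ_N > 0`, `r_N ≥ 0` such that for all `s`, `m_T ≥ s + 1`, `K ≥ 1`, refinements `r` and cubes `□_k` of FILE 73's cover, on `MP (paramsOf d L m_T K hL)`,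
  `𝔇((M_{χ′}G′^{↑}(□_k))∘[a•Q′*Q′ − ∂Π∂*′, M_{h′_k}], (M_χG^{↑}(□_k))∘[a•Q*Q − ∂Π∂*, M_{h_k}]) ≤ 1_{□_k}(y)·r_N·(L^K)^{−γ_N}·e^{−δ_N|y−y′|_T}`
(`γ_N = 1∕16`) — FILE 105 §2 fed with P-IId `hasMaj_chiCube_liftCubeG_fine`, P-IIc `hasMaj_idef_chiCube_liftCubeG` (`γ = 1∕8`), `hasMaj_landauRe`, FILE 99 `hasMaj_idef_nonlocal_family`
(`γ = 1∕8`), all at one rate; `ℓ = ω = π(d+1)∕L^s ≤ π(d+1)`, `o ≤ π(d+1)(L^K)^{−1∕16}` (FILE 100 `nonlocalConst_le`). [cite: Balaban1984PropagatorsI, (1.120)–(1.121) p.37, (1.126)–(1.128) p.38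
(shape + mechanism); Balaban1985BackgroundPropagators, Thm 3.14 pp.426–427 (difference template); King1986, Prop. 3.9 (3.73) p.665 (η-rate shape)] -/
theorem hasMaj_idef_chiCube_knitGR_comp_commOp_nonlocal (hL : Odd L ∧ 1 < L) {a : ℝ} (ha : 0 < a) :
    ∃ δN rN γN : ℝ, 0 < δN ∧ 0 ≤ rN ∧ 0 < γN ∧ ∀ (s mT K r : ℕ) (hs : s + 1 ≤ mT) (_hK : 1 ≤ K) (k : Fin (d + 1) → ZMod (2 * L ^ (mT - s))),
      HasMaj (BlockNorm.ofBlocks (unitTorusGeo L K (MP (paramsOf d L mT K hL)))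
          (fun b : Tor (fine (L ^ K) (MP (paramsOf d L mT K hL))) × Fin (d + 1) => blockOf (L ^ K) (MP (paramsOf d L mT K hL)) b.1))
        (BlockNorm.ofBlocks (unitTorusGeo L K (MP (paramsOf d L mT K hL)))
          (fun x : Tor (fine (L ^ r * L ^ K) (MP (paramsOf d L mT K hL))) × Fin (d + 1) => blockOf (L ^ r * L ^ K) (MP (paramsOf d L mT K hL)) x.1))
        (idef (pull (kingPrV L K r (MP (paramsOf d L mT K hL)))) (pull (kingPrV L K r (MP (paramsOf d L mT K hL))))
          ((mulOp (chiCube (MP (paramsOf d L mT K hL)) (L ^ r * L ^ K) (coverCorner (MP (paramsOf d L mT K hL)) (L ^ s) (L ^ (mT - s)) (coverMargin L s) k) (L ^ (s + 1))) ∘ₗ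
              knitGR d L s mT K (L ^ r * L ^ K) hL hs a k) ∘ₗ
            commOp (a • (qvAdjRe (MP (paramsOf d L mT K hL)) (L ^ r * L ^ K) ∘ₗ qvRe (MP (paramsOf d L mT K hL)) (L ^ r * L ^ K)) +
              (-landauRe (MP (paramsOf d L mT K hL)) (L ^ r * L ^ K))) (knitHR d L s mT K (L ^ r * L ^ K) hL k))
          ((mulOp (chiCube (MP (paramsOf d L mT K hL)) (L ^ K) (coverCorner (MP (paramsOf d L mT K hL)) (L ^ s) (L ^ (mT - s)) (coverMargin L s) k) (L ^ (s + 1))) ∘ₗ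
              knitGR d L s mT K (L ^ K) hL hs a k) ∘ₗ
            commOp (a • (qvAdjRe (MP (paramsOf d L mT K hL)) (L ^ K) ∘ₗ qvRe (MP (paramsOf d L mT K hL)) (L ^ K)) +
              (-landauRe (MP (paramsOf d L mT K hL)) (L ^ K))) (knitHR d L s mT K (L ^ K) hL k)))
        (fun y y' => ind ((cubeBlocks (MP (paramsOf d L mT K hL)) (coverCorner (MP (paramsOf d L mT K hL)) (L ^ s) (L ^ (mT - s)) (coverMargin L s) k) (L ^ (s + 1)) : Finset _) : Set _) y *
          (rN * ((L : ℝ) ^ K) ^ (-γN) * Real.exp (-(δN * tdistT (MP (paramsOf d L mT K hL)) y y')))) := by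
  have hL3 : 3 ≤ L := by obtain ⟨⟨j, hj⟩, h1⟩ := hL; omega
  have hLpos : 0 < L := by omega
  have hL1 : 1 ≤ L := hLpos
  have hLodd : Odd L := hL.1
  have hL2 : 2 ≤ L := hL.2
  -- programme P's letters (fine cut row of the lifted cube, its two-grid defect), `∂Π∂*`, and FILE 99's operator letter
  obtain ⟨δ₀, C, hδ₀, hC, HG'⟩ := hasMaj_chiCube_liftCubeG_fine (d := d) hL ha
  obtain ⟨δ₁, C₁, hδ₁, hC₁, HL⟩ := hasMaj_landauRe (d := d) (L := L)
  obtain ⟨δc, mc, hδc, hmc, HC⟩ := hasMaj_idef_chiCube_liftCubeG (d := d) hLodd hL2 ha (γ := 1 / 8) (by norm_num) (by norm_num)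
  obtain ⟨δ₂, r₂, hδ₂, hr₂, HN⟩ := hasMaj_idef_nonlocal_family (d := d) hLodd hL2 ha (γ := 1 / 8) (by norm_num) (by norm_num)
  -- one rate
  obtain ⟨δx, hδx_def⟩ : ∃ δx : ℝ, δx = min (min δ₀ δ₁) (min δc δ₂) := ⟨_, rfl⟩
  have hδx : 0 < δx := hδx_def ▸ lt_min (lt_min hδ₀ hδ₁) (lt_min hδc hδ₂)
  have dδ0 : δx ≤ δ₀ := hδx_def ▸ (min_le_left _ _).trans (min_le_left _ _)
  have dδ1 : δx ≤ δ₁ := hδx_def ▸ (min_le_left _ _).trans (min_le_right _ _)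
  have dδc : δx ≤ δc := hδx_def ▸ (min_le_right _ _).trans (min_le_left _ _)
  have dδ2 : δx ≤ δ₂ := hδx_def ▸ (min_le_right _ _).trans (min_le_right _ _)
  have hcr : 0 ≤ B4Sect5Proof.latticeConst (d + 1) (δx / 4) := B4Sect5Proof.latticeConst_nonneg (d + 1) (by positivity)
  -- the uniform constant (`w = L^s ≥ 1`: `ℓ ≤ ℓ₀ = π(d+1)`)
  refine ⟨δx / 2, (C * ((π * (d + 1) * (Real.exp 1 * (δx / 4))⁻¹ + 2 * (π * (d + 1))) * r₂ + 2 * (π * (d + 1)) * (|a| * (Real.exp δx * Real.exp δx) + C₁)) +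
      mc * ((π * (d + 1) * (Real.exp 1 * (δx / 4))⁻¹ + 2 * (π * (d + 1))) * (|a| * (Real.exp δx * Real.exp δx) + C₁))) * B4Sect5Proof.latticeConst (d + 1) (δx / 4),
    1 / 8 / 2, by positivity, by positivity, by norm_num, fun s mT K r hs hK k => ?_⟩
  -- the index's data
  have hs' : s ≤ mT := by omega
  have hM : ∀ ν, MP (paramsOf d L mT K hL) ν = 2 * L ^ (mT - s) * L ^ s := MP_eq_two_mul L s mT K hL hs'
  have hw : 0 < L ^ s := pow_pos hLpos s
  have hn : 1 ≤ L ^ K := Nat.one_le_pow _ _ hLpos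
  have hwR : (1 : ℝ) ≤ ((L ^ s : ℕ) : ℝ) := by exact_mod_cast hw
  have hx : (1 : ℝ) ≤ (L : ℝ) ^ K := one_le_pow₀ (by exact_mod_cast hL1)
  have hxcast : ((L ^ K : ℕ) : ℝ) = (L : ℝ) ^ K := Nat.cast_pow L K
  -- the rate factor `θ = (L^K)^{−1∕16}` and the carriers' domination
  have hθ0 : 0 ≤ ((L : ℝ) ^ K) ^ (-(1 / 8 / 2 : ℝ)) := Real.rpow_nonneg (zero_le_one.trans hx) _
  have he16 : ((L ^ K : ℕ) : ℝ) ^ (-(1 / 8 / 2 : ℝ)) = ((L : ℝ) ^ K) ^ (-(1 / 8 / 2 : ℝ)) := by rw [hxcast]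
  have hℓ : π * (d + 1) / ((L ^ s : ℕ) : ℝ) ≤ π * (d + 1) := div_le_self (by positivity) hwR
  have ho : π * (d + 1) / (((L ^ K : ℕ) : ℝ) * ((L ^ s : ℕ) : ℝ)) ≤ π * (d + 1) * ((L : ℝ) ^ K) ^ (-(1 / 8 / 2 : ℝ)) := by
    rw [div_eq_mul_inv]
    refine mul_le_mul_of_nonneg_left ?_ (by positivity)
    calc (((L ^ K : ℕ) : ℝ) * ((L ^ s : ℕ) : ℝ))⁻¹ ≤ (((L ^ K : ℕ) : ℝ))⁻¹ := by
          rw [mul_inv]; exact mul_le_of_le_one_right (by positivity) (inv_le_one_of_one_le₀ hwR)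
      _ = ((L : ℝ) ^ K) ^ (-(1 : ℝ)) := by rw [hxcast, Real.rpow_neg_one]
      _ ≤ ((L : ℝ) ^ K) ^ (-(1 / 8 / 2 : ℝ)) := Real.rpow_le_rpow_of_exponent_le hx (by norm_num)
  -- the letters at this index, at the rate `δx`
  have hGc' := (HG' (s + 1) mT K r hs hK (coverCorner (MP (paramsOf d L mT K hL)) (L ^ s) (L ^ (mT - s)) (coverMargin L s) k)).mono fun y y' =>
    maj₂_weaken le_rfl hC.le dδ0 y y'
  have hNL := (HL K (L ^ K) (MP (paramsOf d L mT K hL))).mono fun y y' => maj₀_weaken le_rfl hC₁.le dδ1 y y'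
  have hNL' := (HL K (L ^ r * L ^ K) (MP (paramsOf d L mT K hL))).mono fun y y' => maj₀_weaken le_rfl hC₁.le dδ1 y y'
  have hIG := by
    have h := HC (s + 1) mT K r hK hL hs (coverCorner (MP (paramsOf d L mT K hL)) (L ^ s) (L ^ (mT - s)) (coverMargin L s) k)
    rw [he16] at h
    exact h.mono fun y y' => maj₂_weaken (le_refl (mc * ((L : ℝ) ^ K) ^ (-(1 / 8 / 2 : ℝ)))) (mul_nonneg hmc.le hθ0) dδc y y'
  have hDN := by
    have h := HN mT K r hK hL
    rw [he16] at h
    exact h.mono fun y y' => maj₀_weaken (le_refl (r₂ * ((L : ℝ) ^ K) ^ (-(1 / 8 / 2 : ℝ)))) (mul_nonneg hr₂.le hθ0) dδ2 y y'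
  -- FILE 105 §2 per cube
  have hcube := hasMaj_idef_cut_comp_commOp_nonlocal_of_row (L := L) (kk := K) (r := r) (q := L ^ (mT - s)) (w := L ^ s) hM hw k
    (coverCorner (MP (paramsOf d L mT K hL)) (L ^ s) (L ^ (mT - s)) (coverMargin L s) k) (L ^ (s + 1)) hC.le hδx hC₁.le (mul_nonneg hmc.le hθ0) (mul_nonneg hr₂.le hθ0)
    hGc' hNL hNL' hIG hDN
  refine hcube.mono fun y y' => mul_le_mul_of_nonneg_left (mul_le_mul_of_nonneg_right ?_ (Real.exp_nonneg _)) (ind_nonneg _ _)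
  exact nonlocalConst_le hC.le (by positivity) (by positivity) hcr hmc.le hr₂.le (by positivity) hℓ hθ0 ho rfl rfl

end Family

end Summit.QuantumFields.YangMills.BalabanUVNodes.N15.Gluing

end
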